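import Summits.RiemannHypothesis.RiemannHypothesis.Theses.IntegerScrew

/-!
# Tensor reduction: two ONE-lattice moment-blind towers ⇒ `¬ IntegerScrew.TwoPrimeFoldRigidity`

HONEST LABEL.  Negative-side helper toward `¬ IntegerScrew.TwoPrimeFoldRigidity` (L62 K1 = item
stmt-RiemannHypothesis-25784); record-negative programme (a two-lattice BLINDNESS construction = negative knowledge
about the sampling set `ℕ⁺ log 2 ∪ ℕ⁺ log 3`); 0 toward RH.  RH is not proved, not used, not mentioned below.
Nothing here bears on the truth of RH.

MECHANISM (tensor product; cdisprove-25784 g0).  A *moment-blind tower* for ONE lattice `hℕ⁺` is a positive,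
locally finite family `(μ_p, κ_p)` in `0 < Re κ < A`, `Im κ > 1`, `Σ μ‖κ‖² < ∞`, whose three exponential moment sums
`Σ_p μ_p κ̄_pʳ e^{κ_p t}` (`r = 0, 1, 2`) VANISH at every `t ∈ hℕ⁺`.  Given one tower for
`log 2` and one for `log 3` (index types `P`, `Q`), the PRODUCT configuration on `P × Q`,
`κ_{pq} = κ_p + κ'_q`, `m_{pq} = μ_p ν_q ‖κ_{pq}‖⁴ / 4`, has `4 m (cosh κt − 1)/κ² = μν κ̄_{pq}² (cosh κ_{pq} t − 1)`
and `κ̄_{pq}² e^{κ_{pq} t} = Σ_{a+b=2} binom · (κ̄_pᵃ e^{κ_p t}) (κ̄'_qᵇ e^{κ'_q t})`: the growing part of EITHER prime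
fold is a finite combination of products of one-lattice moment sums, one factor of which vanishes on that lattice —
no cross-lattice spill, no Diophantine input, any two steps.  The decaying and constant parts are bounded by
`3 Σ μν(‖κ_p‖² + ‖κ'_q‖²)`, so both folds are bounded while `P × Q` is nonempty: K1 fails.

CONTENTS: `twoPrimeFoldRigidity_false_of_towers` — the tower data of both lattices as explicit hypotheses
`⊢ ¬ TwoPrimeFoldRigidity` (kernel-checked, no sorry, no new definitions).  The towers themselves are constructed in
`Negative/MomentBlindTower.lean` (cubed-gon residual tower on one lattice).
-/

set_option linter.dupNamespace false

noncomputable section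

open scoped ComplexConjugate

namespace Summit.RiemannHypothesis.RiemannHypothesis.Theorems.TwoPrimeFoldRigidity.Negative

/-! ## One-lattice families: absolute summability of the moment terms -/

/-- `Im z > 1 ⇒ ‖z‖ ≥ 1`. -/
theorem one_le_norm_of_one_lt_im {z : ℂ} (hz : 1 < z.im) : 1 ≤ ‖z‖ :=
  le_trans hz.le (le_trans (le_abs_self _) (Complex.abs_im_le_norm z))

/-- norm of one moment term `μ κ̄ʳ e^{κt}` (`r ≤ 2`, `t ≥ 0`, `Re κ ≤ A`, `‖κ‖ ≥ 1`) is at most `μ‖κ‖² e^{At}`. -/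
theorem norm_moment_term_le {μ : ℝ} (hμ : 0 ≤ μ) {κ : ℂ} {A : ℝ} (hre : (κ).re ≤ A) (h1 : 1 ≤ ‖κ‖)
    {t : ℝ} (ht : 0 ≤ t) {r : ℕ} (hr : r ≤ 2) :
    ‖(μ : ℂ) * conj κ ^ r * Complex.exp (κ * (t : ℂ))‖ ≤ μ * ‖κ‖ ^ 2 * Real.exp (A * t) := by
  rw [norm_mul, norm_mul, Complex.norm_real, Real.norm_of_nonneg hμ, norm_pow, Complex.norm_conj,
    Complex.norm_exp]
  have hre' : (κ * (t : ℂ)).re = κ.re * t := by simp [Complex.mul_re]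
  rw [hre']
  gcongr

/-- the moment families of a tower-like family are absolutely summable at every `t ≥ 0`. -/
theorem summable_norm_moment {ι : Type} {μ : ι → ℝ} {κ : ι → ℂ} {A : ℝ} (hμ : ∀ i, 0 ≤ μ i)
    (hre : ∀ i, (κ i).re ≤ A) (h1 : ∀ i, 1 ≤ ‖κ i‖) (hs : Summable (fun i ↦ μ i * ‖κ i‖ ^ 2))
    {t : ℝ} (ht : 0 ≤ t) {r : ℕ} (hr : r ≤ 2) :
    Summable (fun i ↦ ‖(μ i : ℂ) * conj (κ i) ^ r * Complex.exp (κ i * (t : ℂ))‖) :=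
  Summable.of_nonneg_of_le (fun _ ↦ norm_nonneg _) (fun i ↦ norm_moment_term_le (hμ i) (hre i) (h1 i) ht hr)
    (hs.mul_right (Real.exp (A * t)))


/-! ## The product configuration: growing part -/

/-- binomial expansion of the product moment term. -/
theorem product_term_expand (μ ν : ℝ) (κ κ' : ℂ) (t : ℂ) :
    ((μ * ν : ℝ) : ℂ) * conj (κ + κ') ^ 2 * Complex.exp ((κ + κ') * t) =
      ((μ : ℂ) * conj κ ^ 2 * Complex.exp (κ * t)) * ((ν : ℂ) * conj κ' ^ 0 * Complex.exp (κ' * t)) +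
      2 * (((μ : ℂ) * conj κ ^ 1 * Complex.exp (κ * t)) * ((ν : ℂ) * conj κ' ^ 1 * Complex.exp (κ' * t))) +
      ((μ : ℂ) * conj κ ^ 0 * Complex.exp (κ * t)) * ((ν : ℂ) * conj κ' ^ 2 * Complex.exp (κ' * t)) := by
  rw [add_mul, Complex.exp_add, map_add]
  push_cast
  ring

/-- product of two absolutely convergent series over the product index type. -/
theorem hasSum_prod_mul {P Q : Type} {f : P → ℂ} {g : Q → ℂ} {a b : ℂ} (hf : HasSum f a) (hg : HasSum g b)
    (hfa : Summable fun p ↦ ‖f p‖) (hga : Summable fun q ↦ ‖g q‖) :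
    HasSum (fun pq : P × Q ↦ f pq.1 * g pq.2) (a * b) :=
  hf.mul hg (summable_mul_of_summable_norm hfa hga)

/-- **No cross spill.**  If the one-lattice moment sums of `(μ, κ)` and `(ν, κ')` at time `t` have values `s r`,
`s' r` (`r = 0,1,2`), all absolutely convergent, then the growing part of the product configuration has sum
`s 2 * s' 0 + 2 * (s 1 * s' 1) + s 0 * s' 2`. -/
theorem hasSum_product_grow {P Q : Type} (μ : P → ℝ) (κ : P → ℂ) (ν : Q → ℝ) (κ' : Q → ℂ) (t : ℂ)
    (s s' : ℕ → ℂ)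
    (hs : ∀ r, r ≤ 2 → HasSum (fun p ↦ (μ p : ℂ) * conj (κ p) ^ r * Complex.exp (κ p * t)) (s r))
    (hs' : ∀ r, r ≤ 2 → HasSum (fun q ↦ (ν q : ℂ) * conj (κ' q) ^ r * Complex.exp (κ' q * t)) (s' r))
    (ha : ∀ r, r ≤ 2 → Summable (fun p ↦ ‖(μ p : ℂ) * conj (κ p) ^ r * Complex.exp (κ p * t)‖))
    (ha' : ∀ r, r ≤ 2 → Summable (fun q ↦ ‖(ν q : ℂ) * conj (κ' q) ^ r * Complex.exp (κ' q * t)‖)) :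
    HasSum (fun pq : P × Q ↦ ((μ pq.1 * ν pq.2 : ℝ) : ℂ) * conj (κ pq.1 + κ' pq.2) ^ 2 *
      Complex.exp ((κ pq.1 + κ' pq.2) * t)) (s 2 * s' 0 + 2 * (s 1 * s' 1) + s 0 * s' 2) := by
  have two : (2 : ℕ) ≤ 2 := le_rfl
  have one : (1 : ℕ) ≤ 2 := by norm_num
  have zero : (0 : ℕ) ≤ 2 := by norm_num
  have k20 := hasSum_prod_mul (hs 2 two) (hs' 0 zero) (ha 2 two) (ha' 0 zero)
  have k11 := hasSum_prod_mul (hs 1 one) (hs' 1 one) (ha 1 one) (ha' 1 one)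
  have k02 := hasSum_prod_mul (hs 0 zero) (hs' 2 two) (ha 0 zero) (ha' 2 two)
  have h := (k20.add (k11.mul_left 2)).add k02
  convert h using 1
  funext pq
  exact product_term_expand (μ pq.1) (ν pq.2) (κ pq.1) (κ' pq.2) t

/-! ## The product configuration: the fold is bounded -/

/-- `‖K‖⁴ / K² = K̄²` for `K ≠ 0`. -/
theorem norm_sq_conj_div_sq {K : ℂ} (hK : K ≠ 0) : ((‖K‖ ^ 4 : ℝ) : ℂ) / K ^ 2 = conj K ^ 2 := by
  have h1 : ((‖K‖ ^ 4 : ℝ) : ℂ) = (K * conj K) ^ 2 := by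
    rw [Complex.mul_conj, Complex.normSq_eq_norm_sq]; push_cast; ring
  rw [h1, div_eq_iff (pow_ne_zero 2 hK)]
  ring

/-- termwise identity: with `m = μν‖K‖⁴/4`, `4 m Re[(cosh Kt − 1)/K²] = Re[μν K̄² (cosh Kt − 1)]`. -/
theorem fold_term_eq (μ ν : ℝ) {K : ℂ} (hK : K ≠ 0) (t : ℂ) :
    4 * (μ * ν * ‖K‖ ^ 4 / 4) * ((Complex.cosh (K * t) - 1) / K ^ 2).re =
      (((μ * ν : ℝ) : ℂ) * conj K ^ 2 * (Complex.cosh (K * t) - 1)).re := by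
  have : 4 * (μ * ν * ‖K‖ ^ 4 / 4) * ((Complex.cosh (K * t) - 1) / K ^ 2).re =
      ((((μ * ν : ℝ)) : ℂ) * ((((‖K‖ ^ 4 : ℝ) : ℂ) / K ^ 2) * (Complex.cosh (K * t) - 1))).re := by
    rw [Complex.re_ofReal_mul, ← mul_div_right_comm, ← mul_div_assoc, mul_div_right_comm,
      show ((‖K‖ ^ 4 : ℝ) : ℂ) = ((‖K‖ ^ 4 : ℝ) : ℂ) from rfl]
    rw [show ((‖K‖ ^ 4 : ℝ) : ℂ) * (Complex.cosh (K * t) - 1) / K ^ 2 =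
      ((‖K‖ ^ 4 : ℝ) : ℂ) * ((Complex.cosh (K * t) - 1) / K ^ 2) from mul_div_assoc _ _ _,
      Complex.re_ofReal_mul]
    ring
  rw [this, norm_sq_conj_div_sq hK, mul_assoc]


/-- **Bounded fold.**  If the growing part of the product configuration vanishes at a time `t ≥ 0`, the fold
`Σ 4m Re[(cosh κt − 1)/κ²]` there is bounded by `3/2 · Σ μν‖κ_p + κ'_q‖²` (decaying + constant parts). -/
theorem abs_fold_tsum_le {P Q : Type} (μ : P → ℝ) (κ : P → ℂ) (ν : Q → ℝ) (κ' : Q → ℂ)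
    (hμ : ∀ p, 0 ≤ μ p) (hν : ∀ q, 0 ≤ ν q) (hre : ∀ pq : P × Q, 0 ≤ (κ pq.1 + κ' pq.2).re)
    (hK : ∀ pq : P × Q, κ pq.1 + κ' pq.2 ≠ 0)
    (hs1 : Summable fun pq : P × Q ↦ μ pq.1 * ν pq.2 * ‖κ pq.1 + κ' pq.2‖ ^ 2)
    {t : ℝ} (ht : 0 ≤ t)
    (hgrow : HasSum (fun pq : P × Q ↦ ((μ pq.1 * ν pq.2 : ℝ) : ℂ) * conj (κ pq.1 + κ' pq.2) ^ 2 *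
      Complex.exp ((κ pq.1 + κ' pq.2) * (t : ℂ))) 0) :
    |∑' pq : P × Q, 4 * (μ pq.1 * ν pq.2 * ‖κ pq.1 + κ' pq.2‖ ^ 4 / 4) *
        ((Complex.cosh ((κ pq.1 + κ' pq.2) * (t : ℂ)) - 1) / (κ pq.1 + κ' pq.2) ^ 2).re|
      ≤ 3 / 2 * ∑' pq : P × Q, μ pq.1 * ν pq.2 * ‖κ pq.1 + κ' pq.2‖ ^ 2 := by
  set M := ∑' pq : P × Q, μ pq.1 * ν pq.2 * ‖κ pq.1 + κ' pq.2‖ ^ 2 with hM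
  have hMs : HasSum (fun pq : P × Q ↦ μ pq.1 * ν pq.2 * ‖κ pq.1 + κ' pq.2‖ ^ 2) M := hs1.hasSum
  -- decaying family
  set D : P × Q → ℂ := fun pq ↦ ((μ pq.1 * ν pq.2 : ℝ) : ℂ) * conj (κ pq.1 + κ' pq.2) ^ 2 *
      Complex.exp (-((κ pq.1 + κ' pq.2) * (t : ℂ))) with hD
  have hDle : ∀ pq, ‖D pq‖ ≤ μ pq.1 * ν pq.2 * ‖κ pq.1 + κ' pq.2‖ ^ 2 := by
    intro pq
    simp only [hD, norm_mul, Complex.norm_real, norm_pow, Complex.norm_conj, Complex.norm_exp,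
      Real.norm_of_nonneg (mul_nonneg (hμ pq.1) (hν pq.2))]
    have : Real.exp (-((κ pq.1 + κ' pq.2) * (t : ℂ))).re ≤ 1 := by
      rw [Real.exp_le_one_iff, Complex.neg_re]
      have : ((κ pq.1 + κ' pq.2) * (t : ℂ)).re = (κ pq.1 + κ' pq.2).re * t := by
        simp [Complex.mul_re]
      rw [this]
      exact neg_nonpos.mpr (mul_nonneg (hre pq) ht)
    exact mul_le_of_le_one_right (mul_nonneg (mul_nonneg (hμ pq.1) (hν pq.2)) (sq_nonneg _)) this
  have hDs : Summable D := Summable.of_norm_bounded hs1 hDle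
  have hDn : ‖∑' pq, D pq‖ ≤ M := hDs.hasSum.norm_le_of_bounded hMs hDle
  -- constant family
  set C : P × Q → ℂ := fun pq ↦ ((μ pq.1 * ν pq.2 : ℝ) : ℂ) * conj (κ pq.1 + κ' pq.2) ^ 2 with hC
  have hCle : ∀ pq, ‖C pq‖ ≤ μ pq.1 * ν pq.2 * ‖κ pq.1 + κ' pq.2‖ ^ 2 := by
    intro pq
    simp only [hC, norm_mul, Complex.norm_real, norm_pow, Complex.norm_conj,
      Real.norm_of_nonneg (mul_nonneg (hμ pq.1) (hν pq.2))]
    exact le_rfl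
  have hCs : Summable C := Summable.of_norm_bounded hs1 hCle
  have hCn : ‖∑' pq, C pq‖ ≤ M := hCs.hasSum.norm_le_of_bounded hMs hCle
  -- the complex fold family
  have hG : HasSum (fun pq : P × Q ↦ ((μ pq.1 * ν pq.2 : ℝ) : ℂ) * conj (κ pq.1 + κ' pq.2) ^ 2 *
      (Complex.cosh ((κ pq.1 + κ' pq.2) * (t : ℂ)) - 1))
      ((1 / 2) * 0 + (1 / 2) * ∑' pq, D pq - ∑' pq, C pq) := by
    have h := ((hgrow.mul_left (1 / 2)).add (hDs.hasSum.mul_left (1 / 2))).sub hCs.hasSum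
    have e : (fun pq : P × Q ↦ ((μ pq.1 * ν pq.2 : ℝ) : ℂ) * conj (κ pq.1 + κ' pq.2) ^ 2 *
        (Complex.cosh ((κ pq.1 + κ' pq.2) * (t : ℂ)) - 1)) =
        (fun pq : P × Q ↦ 1 / 2 * (((μ pq.1 * ν pq.2 : ℝ) : ℂ) * conj (κ pq.1 + κ' pq.2) ^ 2 *
          Complex.exp ((κ pq.1 + κ' pq.2) * (t : ℂ))) + 1 / 2 * D pq - C pq) := by
      funext pq
      simp only [hD, hC, Complex.cosh]
      ring
    rw [e]
    exact h
  -- real parts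
  have hGre := ((Complex.hasSum_iff _ _).mp hG).1
  have hF : HasSum (fun pq : P × Q ↦ 4 * (μ pq.1 * ν pq.2 * ‖κ pq.1 + κ' pq.2‖ ^ 4 / 4) *
      ((Complex.cosh ((κ pq.1 + κ' pq.2) * (t : ℂ)) - 1) / (κ pq.1 + κ' pq.2) ^ 2).re)
      ((1 / 2) * 0 + (1 / 2) * ∑' pq, D pq - ∑' pq, C pq).re := by
    convert hGre using 1
    funext pq
    exact fold_term_eq (μ pq.1) (ν pq.2) (hK pq) (t : ℂ)
  rw [hF.tsum_eq]
  calc |((1 / 2 : ℂ) * 0 + (1 / 2) * ∑' pq, D pq - ∑' pq, C pq).re|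
      ≤ ‖(1 / 2 : ℂ) * 0 + (1 / 2) * ∑' pq, D pq - ∑' pq, C pq‖ := Complex.abs_re_le_norm _
    _ ≤ ‖(1 / 2 : ℂ) * 0 + (1 / 2) * ∑' pq, D pq‖ + ‖∑' pq, C pq‖ := norm_sub_le _ _
    _ ≤ (1 / 2) * M + M := by
        gcongr
        rw [mul_zero, zero_add, norm_mul]
        have : ‖(1 / 2 : ℂ)‖ = 1 / 2 := by simp
        rw [this]
        gcongr
    _ = 3 / 2 * M := by ring

/-- `|Re K| ≤ 1 ≤ Im K ⇒ ‖K‖² ≤ 2 (Im K)²`. -/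
theorem norm_sq_le_two_mul_im_sq {K : ℂ} (hre : |K.re| ≤ 1) (him : 1 ≤ K.im) : ‖K‖ ^ 2 ≤ 2 * K.im ^ 2 := by
  rw [Complex.sq_norm, Complex.normSq_apply]
  have h1 : K.re * K.re ≤ 1 := by
    have := abs_le.mp hre
    nlinarith
  nlinarith

/-- **Tensor reduction.**  Two ONE-lattice *moment-blind towers* below abscissa `1/4` — nonempty, positive,
locally finite families `(μ, κ)` on `P` and `(ν, κ')` on `Q` with `0 < Re < 1/4`, `1 < Im`, `Σ μ‖κ‖² < ∞`, whose
moment sums `Σ μ κ̄ʳ e^{κ t}` (`r = 0, 1, 2`) vanish at every `t ∈ ℕ⁺ log 2`, resp. `t ∈ ℕ⁺ log 3` — refute K1: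
their product configuration `κ_p + κ'_q`, `m = μν‖κ_p + κ'_q‖⁴/4` satisfies every hypothesis of
`TwoPrimeFoldRigidity` on the nonempty index type `P × Q`. -/
theorem twoPrimeFoldRigidity_false_of_towers {P Q : Type} (hPne : Nonempty P) (hQne : Nonempty Q)
    (μ : P → ℝ) (κ : P → ℂ) (ν : Q → ℝ) (κ' : Q → ℂ)
    (hμ : ∀ p, 0 < μ p) (hκre : ∀ p, 0 < (κ p).re ∧ (κ p).re < 1 / 4) (hκim : ∀ p, 1 < (κ p).im)
    (hκfin : ∀ T : ℝ, {p | (κ p).im ≤ T}.Finite) (hκsum : Summable (fun p ↦ μ p * ‖κ p‖ ^ 2))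
    (hκblind : ∀ k : ℕ, 1 ≤ k → ∀ r : ℕ, r ≤ 2 →
      HasSum (fun p ↦ (μ p : ℂ) * conj (κ p) ^ r * Complex.exp (κ p * (((k : ℝ) * Real.log 2 : ℝ) : ℂ))) 0)
    (hν : ∀ q, 0 < ν q) (hκ're : ∀ q, 0 < (κ' q).re ∧ (κ' q).re < 1 / 4) (hκ'im : ∀ q, 1 < (κ' q).im)
    (hκ'fin : ∀ T : ℝ, {q | (κ' q).im ≤ T}.Finite) (hκ'sum : Summable (fun q ↦ ν q * ‖κ' q‖ ^ 2))
    (hκ'blind : ∀ k : ℕ, 1 ≤ k → ∀ r : ℕ, r ≤ 2 →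
      HasSum (fun q ↦ (ν q : ℂ) * conj (κ' q) ^ r * Complex.exp (κ' q * (((k : ℝ) * Real.log 3 : ℝ) : ℂ))) 0) :
    ¬ Summit.RiemannHypothesis.RiemannHypothesis.Theses.IntegerScrew.TwoPrimeFoldRigidity := by
  intro hK1
  have h1κ : ∀ p, 1 ≤ ‖κ p‖ := fun p ↦ one_le_norm_of_one_lt_im (hκim p)
  have h1κ' : ∀ q, 1 ≤ ‖κ' q‖ := fun q ↦ one_le_norm_of_one_lt_im (hκ'im q)
  have hKim : ∀ pq : P × Q, 2 < (κ pq.1 + κ' pq.2).im := by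
    intro pq; rw [Complex.add_im]; linarith [hκim pq.1, hκ'im pq.2]
  have hKre : ∀ pq : P × Q, 0 < (κ pq.1 + κ' pq.2).re ∧ (κ pq.1 + κ' pq.2).re < 1 / 2 := by
    intro pq; rw [Complex.add_re]; constructor <;> linarith [hκre pq.1, hκ're pq.2]
  have hKne : ∀ pq : P × Q, κ pq.1 + κ' pq.2 ≠ 0 := by
    intro pq h
    have := hKim pq
    rw [h, Complex.zero_im] at this
    linarith
  have hμs : Summable μ :=
    Summable.of_nonneg_of_le (fun p ↦ (hμ p).le)
      (fun p ↦ le_mul_of_one_le_right (hμ p).le (one_le_pow₀ (h1κ p))) hκsum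
  have hνs : Summable ν :=
    Summable.of_nonneg_of_le (fun q ↦ (hν q).le)
      (fun q ↦ le_mul_of_one_le_right (hν q).le (one_le_pow₀ (h1κ' q))) hκ'sum
  -- the dominating summable family
  have hM : Summable fun pq : P × Q ↦ μ pq.1 * ν pq.2 * ‖κ pq.1 + κ' pq.2‖ ^ 2 := by
    have hA := hκsum.mul_of_nonneg hνs (fun p ↦ mul_nonneg (hμ p).le (sq_nonneg _)) (fun q ↦ (hν q).le)
    have hB := hμs.mul_of_nonneg hκ'sum (fun p ↦ (hμ p).le) (fun q ↦ mul_nonneg (hν q).le (sq_nonneg _))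
    refine Summable.of_nonneg_of_le (fun pq ↦ mul_nonneg (mul_nonneg (hμ pq.1).le (hν pq.2).le) (sq_nonneg _))
      (fun pq ↦ ?_) ((hA.add hB).mul_left 2)
    have hn := norm_add_le (κ pq.1) (κ' pq.2)
    have hn0 := norm_nonneg (κ pq.1 + κ' pq.2)
    have h2 : ‖κ pq.1 + κ' pq.2‖ ^ 2 ≤ 2 * (‖κ pq.1‖ ^ 2 + ‖κ' pq.2‖ ^ 2) := by
      have e1 : ‖κ pq.1 + κ' pq.2‖ ^ 2 ≤ (‖κ pq.1‖ + ‖κ' pq.2‖) ^ 2 := pow_le_pow_left₀ hn0 hn 2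
      nlinarith [sq_nonneg (‖κ pq.1‖ - ‖κ' pq.2‖)]
    have hμν : 0 ≤ μ pq.1 * ν pq.2 := mul_nonneg (hμ pq.1).le (hν pq.2).le
    calc μ pq.1 * ν pq.2 * ‖κ pq.1 + κ' pq.2‖ ^ 2 ≤ μ pq.1 * ν pq.2 * (2 * (‖κ pq.1‖ ^ 2 + ‖κ' pq.2‖ ^ 2)) := by
          gcongr
      _ = 2 * (μ pq.1 * ‖κ pq.1‖ ^ 2 * ν pq.2 + μ pq.1 * (ν pq.2 * ‖κ' pq.2‖ ^ 2)) := by ring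
  -- summability of the one-lattice moment families at any `t ≥ 0`
  have haP : ∀ (t : ℝ), 0 ≤ t → ∀ r, r ≤ 2 →
      Summable (fun p ↦ ‖(μ p : ℂ) * conj (κ p) ^ r * Complex.exp (κ p * (t : ℂ))‖) :=
    fun t ht r hr ↦ summable_norm_moment (fun p ↦ (hμ p).le) (fun p ↦ (hκre p).2.le) h1κ hκsum ht hr
  have haQ : ∀ (t : ℝ), 0 ≤ t → ∀ r, r ≤ 2 →
      Summable (fun q ↦ ‖(ν q : ℂ) * conj (κ' q) ^ r * Complex.exp (κ' q * (t : ℂ))‖) :=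
    fun t ht r hr ↦ summable_norm_moment (fun q ↦ (hν q).le) (fun q ↦ (hκ're q).2.le) h1κ' hκ'sum ht hr
  -- the fold bound at any time where one tower is blind
  have hfold : ∀ (t : ℝ), 0 ≤ t →
      ((∀ r, r ≤ 2 → HasSum (fun p ↦ (μ p : ℂ) * conj (κ p) ^ r * Complex.exp (κ p * (t : ℂ))) 0) ∨
       (∀ r, r ≤ 2 → HasSum (fun q ↦ (ν q : ℂ) * conj (κ' q) ^ r * Complex.exp (κ' q * (t : ℂ))) 0)) →
      |∑' pq : P × Q, 4 * (μ pq.1 * ν pq.2 * ‖κ pq.1 + κ' pq.2‖ ^ 4 / 4) *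
        ((Complex.cosh ((κ pq.1 + κ' pq.2) * (t : ℂ)) - 1) / (κ pq.1 + κ' pq.2) ^ 2).re|
      ≤ 3 / 2 * ∑' pq : P × Q, μ pq.1 * ν pq.2 * ‖κ pq.1 + κ' pq.2‖ ^ 2 := by
    intro t ht hbl
    refine abs_fold_tsum_le μ κ ν κ' (fun p ↦ (hμ p).le) (fun q ↦ (hν q).le) (fun pq ↦ (hKre pq).1.le)
      hKne hM ht ?_
    rcases hbl with hb | hb
    · have h := hasSum_product_grow μ κ ν κ' (t : ℂ) (fun _ ↦ 0)
        (fun r ↦ ∑' q, (ν q : ℂ) * conj (κ' q) ^ r * Complex.exp (κ' q * (t : ℂ))) hb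
        (fun r hr ↦ (haQ t ht r hr).of_norm.hasSum) (haP t ht) (haQ t ht)
      simpa using h
    · have h := hasSum_product_grow μ κ ν κ' (t : ℂ)
        (fun r ↦ ∑' p, (μ p : ℂ) * conj (κ p) ^ r * Complex.exp (κ p * (t : ℂ))) (fun _ ↦ 0)
        (fun r hr ↦ (haP t ht r hr).of_norm.hasSum) hb (haP t ht) (haQ t ht)
      simpa using h
  -- instantiate K1 on the product configuration
  have hE := hK1 (P × Q) (fun pq ↦ μ pq.1 * ν pq.2 * ‖κ pq.1 + κ' pq.2‖ ^ 4 / 4)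
    (fun pq ↦ κ pq.1 + κ' pq.2)
    (fun pq ↦ by
      have := norm_pos_iff.mpr (hKne pq)
      have := hμ pq.1; have := hν pq.2
      positivity)
    hKre (fun pq ↦ by linarith [hKim pq])
    (fun T ↦ by
      refine ((hκfin T).prod (hκ'fin T)).subset ?_
      intro pq hpq
      simp only [Set.mem_setOf_eq, Complex.add_im] at hpq
      simp only [Set.mem_prod, Set.mem_setOf_eq]
      constructor <;> linarith [hκim pq.1, hκ'im pq.2])
    (by
      refine Summable.of_nonneg_of_le (fun pq ↦ ?_) (fun pq ↦ ?_) (hM.mul_left (1 / 2))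
      · have := hμ pq.1; have := hν pq.2
        positivity
      · have him : 1 ≤ (κ pq.1 + κ' pq.2).im := by linarith [hKim pq]
        have hre1 : |(κ pq.1 + κ' pq.2).re| ≤ 1 := by
          rw [abs_le]; constructor <;> linarith [hKre pq]
        have hn := norm_sq_le_two_mul_im_sq hre1 him
        have hμν : 0 ≤ μ pq.1 * ν pq.2 := mul_nonneg (hμ pq.1).le (hν pq.2).le
        have hi0 : 0 < (κ pq.1 + κ' pq.2).im ^ 2 := by positivity
        rw [div_div, div_le_iff₀ (by positivity)]
        calc μ pq.1 * ν pq.2 * ‖κ pq.1 + κ' pq.2‖ ^ 4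
            = μ pq.1 * ν pq.2 * ‖κ pq.1 + κ' pq.2‖ ^ 2 * ‖κ pq.1 + κ' pq.2‖ ^ 2 := by ring
          _ ≤ μ pq.1 * ν pq.2 * ‖κ pq.1 + κ' pq.2‖ ^ 2 * (2 * (κ pq.1 + κ' pq.2).im ^ 2) := by gcongr
          _ = 1 / 2 * (μ pq.1 * ν pq.2 * ‖κ pq.1 + κ' pq.2‖ ^ 2) * (4 * (κ pq.1 + κ' pq.2).im ^ 2) := by
              ring)
    ⟨_, fun k hk ↦ hfold ((k : ℝ) * Real.log 2) (by positivity)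
      (Or.inl (fun r hr ↦ hκblind k hk r hr))⟩
    ⟨_, fun k hk ↦ hfold ((k : ℝ) * Real.log 3) (by positivity)
      (Or.inr (fun r hr ↦ hκ'blind k hk r hr))⟩
  obtain ⟨p⟩ := hPne
  obtain ⟨q⟩ := hQne
  exact hE.false (p, q)

end Summit.RiemannHypothesis.RiemannHypothesis.Theorems.TwoPrimeFoldRigidity.Negative

end
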